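import Literature.NumberTheory.EllipticCurves.ZpExtension
import Mathlib.LinearAlgebra.TensorProduct.Pi
import Mathlib.LinearAlgebra.Dimension.Free
import Mathlib.NumberTheory.Padics.PadicIntegers
import Mathlib.RingTheory.Finiteness.Cardinality
import HarnessLib

/-!
# The GOOD-PLACE LOCAL BLOCKS of RSL_g's one-pair count — the frame-side Π/Σ bookkeeping of S1⊕:
# `dim_{ℚ₂} (ℚ₂ ⊗_{ℤ₂} Π_i N_i) = Σ_i dim_{ℚ₂} (ℚ₂ ⊗_{ℤ₂} N_i)`, the `2^{nfl w}` copies, and `#(Γ_ℚ ⧸ Γ_n) = p^n`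

Route `ResidualThetaTransportAtTwo` (RTT), crux RSL_g `ResidualSignedLambdaLowerCMAtTwo` (stmt-BirchSwinnertonDyer-22608); width seat
`prover-bsd-wall-tp2-p2x-w3` g16 (`--supports 22608 --as helper`, closes nothing). THEOREMS ONLY (no definition, no named fact, no instance, no notation,
no `sorry`); Mathlib + `ZpExtension` only. Fifth file of the local-block chain (p695381 · p696637 · p696901 · p698653): the AwayTwo frame
(`Cruxes/ResidualSignedLambdaLowerCMAtTwo/AWAYTWO-FRAME-g18.md` §1–§3) types the S₀-side Pontryagin carrier as
`PAway := Π (w : ↥S₀) (c : C w), CharacterModule (Dloc w)`, `C w := absoluteGaloisGroup ℚ ⧸ κ.layerSubgroup (nfl w)`, and the S1⊕ text (Q91/S92) as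
`Module.Finite ℚ_[2] (ℚ_[2] ⊗[ℤ_[2]] PAway_good)` + `π.f * Σ_{good w} 2^{nfl w}·(if ‖ι a_ℓ‖ < 1 then 2 else 0) ≤ lamTwo 2 PAway_good`. With the per-block
values of p698653 (`finrank_baseChange_characterModule_subgroupH1_cofree_eq`, `module_finite_characterModule_subgroupH1_cofree`) the text is the
following bookkeeping, stated generically (any `p`, any finite index types, any finitely generated `ℤ_p`-modules):

* `finrank_baseChange_pi_eq_sum` — `dim_{ℚ_p} (ℚ_p ⊗_{ℤ_p} Π_i N_i) = Σ_i dim_{ℚ_p} (ℚ_p ⊗_{ℤ_p} N_i)` (`TensorProduct.piRight`, `Module.finrank_pi_fintype`);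
  `module_finite_baseChange_pi` — the FIN instance of the product;
* `finrank_baseChange_fun_eq_mul` — constant family: `dim (ℚ_p ⊗ (ι → N)) = #ι · dim (ℚ_p ⊗ N)` (the `c : C w` copies);
* `finrank_baseChange_pi_fun_eq_sum_mul` — the frame's double product `Π w, (C w → N w)`: `= Σ_w #(C w) · dim (ℚ_p ⊗ N w)`;
* `natCard_quotient_layerSubgroup` — `#(Γ_K ⧸ κ.layerSubgroup n) = p^n` (`ZpExtension.index_layerSubgroup`), so `#(C w) = 2^{nfl w}`;
* `sum_mul_le_finrank_baseChange_pi_fun` — the S1⊕ inequality shape: if each block has `f · b w ≤ dim (ℚ_p ⊗ N w)` then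
  `f · Σ_w #(C w) · b w ≤ dim (ℚ_p ⊗ Π w, (C w → N w))`.

BSD is not proved by any of this; RSL_g (22608) is not proved here.
References: [GreenbergVatsal2000] §2 (Prop. 2.4: the local count is additive over the primes of `ℚ_∞` above `S₀`); [Kato2004Asterisque] §13.8 (p. 228).
-/

set_option autoImplicit false
-- the Theorems namespace of this sub repeats the summit name by design (D-0017 nested layout)
set_option linter.dupNamespace false

noncomputable section

open scoped Classical TensorProduct

namespace Summit.BirchSwinnertonDyer.BirchSwinnertonDyer.Theorems.ThetaTransport.LocalBlockCount

section Pi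

variable (p : ℕ) [Fact p.Prime] {ι : Type} [Fintype ι]

/-- **`ℚ_p ⊗_{ℤ_p} Π_i N_i` is finite-dimensional** for finitely generated `N_i` (the FIN clause of S1⊕ for the product carrier). [folklore] -/
theorem module_finite_baseChange_pi (N : ι → Type) [∀ i, AddCommGroup (N i)] [∀ i, Module ℤ_[p] (N i)] [∀ i, Module.Finite ℤ_[p] (N i)] :
    Module.Finite ℚ_[p] (ℚ_[p] ⊗[ℤ_[p]] (Π i, N i)) := by
  infer_instance

/-- **`dim_{ℚ_p} (ℚ_p ⊗_{ℤ_p} Π_i N_i) = Σ_i dim_{ℚ_p} (ℚ_p ⊗_{ℤ_p} N_i)`** for a finite family of finitely generated `ℤ_p`-modules (tensor product commutes with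
finite products, `TensorProduct.piRight`; `Module.finrank_pi_fintype`). [cite: GreenbergVatsal2000, §2 Prop. (2.4)] -/
theorem finrank_baseChange_pi_eq_sum (N : ι → Type) [∀ i, AddCommGroup (N i)] [∀ i, Module ℤ_[p] (N i)] [∀ i, Module.Finite ℤ_[p] (N i)] :
    Module.finrank ℚ_[p] (ℚ_[p] ⊗[ℤ_[p]] (Π i, N i)) = ∑ i, Module.finrank ℚ_[p] (ℚ_[p] ⊗[ℤ_[p]] N i) := by
  rw [(TensorProduct.piRight ℤ_[p] ℚ_[p] ℚ_[p] N).finrank_eq, Module.finrank_pi_fintype]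

/-- **Constant family: `dim_{ℚ_p} (ℚ_p ⊗_{ℤ_p} (ι → N)) = #ι · dim_{ℚ_p} (ℚ_p ⊗_{ℤ_p} N)`** (the `2^{nfl w}` conjugate copies `c : C w` of one block).
[cite: GreenbergVatsal2000, §2 Prop. (2.4)] -/
theorem finrank_baseChange_fun_eq_mul (N : Type) [AddCommGroup N] [Module ℤ_[p] N] [Module.Finite ℤ_[p] N] :
    Module.finrank ℚ_[p] (ℚ_[p] ⊗[ℤ_[p]] (ι → N)) = Fintype.card ι * Module.finrank ℚ_[p] (ℚ_[p] ⊗[ℤ_[p]] N) := by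
  rw [finrank_baseChange_pi_eq_sum p (fun _ : ι ↦ N), Finset.sum_const, Finset.card_univ, smul_eq_mul]

/-- **The frame's double product**: for blocks `N w` repeated over finite index types `C w`,
`dim_{ℚ_p} (ℚ_p ⊗_{ℤ_p} Π w, (C w → N w)) = Σ_w #(C w) · dim_{ℚ_p} (ℚ_p ⊗_{ℤ_p} N w)`. [cite: GreenbergVatsal2000, §2 Prop. (2.4)] -/
theorem finrank_baseChange_pi_fun_eq_sum_mul (C : ι → Type) [∀ w, Fintype (C w)] (N : ι → Type) [∀ w, AddCommGroup (N w)]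
    [∀ w, Module ℤ_[p] (N w)] [∀ w, Module.Finite ℤ_[p] (N w)] :
    Module.finrank ℚ_[p] (ℚ_[p] ⊗[ℤ_[p]] (Π w, (C w → N w))) = ∑ w, Fintype.card (C w) * Module.finrank ℚ_[p] (ℚ_[p] ⊗[ℤ_[p]] N w) := by
  rw [finrank_baseChange_pi_eq_sum p (fun w ↦ C w → N w)]
  exact Finset.sum_congr rfl fun w _ ↦ finrank_baseChange_fun_eq_mul p (N w)

/-- **The S1⊕ inequality shape**: per-block lower bounds `f · b w ≤ dim_{ℚ_p} (ℚ_p ⊗ N w)` sum to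
`f · Σ_w #(C w) · b w ≤ dim_{ℚ_p} (ℚ_p ⊗ Π w, (C w → N w))` (with `#(C w) = 2^{nfl w}` and `b w = (if ‖ι a_ℓ‖ < 1 then 2 else 0)` this is
`π.f * Σ_good ≤ lamTwo 2 PAway_good`). [cite: GreenbergVatsal2000, §2 Prop. (2.4)] [cite: Kato2004Asterisque, §13.8 (p. 228)] -/
theorem sum_mul_le_finrank_baseChange_pi_fun (C : ι → Type) [∀ w, Fintype (C w)] (N : ι → Type) [∀ w, AddCommGroup (N w)]
    [∀ w, Module ℤ_[p] (N w)] [∀ w, Module.Finite ℤ_[p] (N w)] (f : ℕ) (b : ι → ℕ)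
    (hb : ∀ w, f * b w ≤ Module.finrank ℚ_[p] (ℚ_[p] ⊗[ℤ_[p]] N w)) :
    f * ∑ w, Fintype.card (C w) * b w ≤ Module.finrank ℚ_[p] (ℚ_[p] ⊗[ℤ_[p]] (Π w, (C w → N w))) := by
  rw [finrank_baseChange_pi_fun_eq_sum_mul p C N, Finset.mul_sum]
  refine Finset.sum_le_sum fun w _ ↦ ?_
  calc f * (Fintype.card (C w) * b w) = Fintype.card (C w) * (f * b w) := by ring
    _ ≤ Fintype.card (C w) * Module.finrank ℚ_[p] (ℚ_[p] ⊗[ℤ_[p]] N w) := Nat.mul_le_mul_left _ (hb w)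

end Pi

section Layer

open Literature.NumberTheory.EllipticCurves

variable {K : Type} [Field K] {p : ℕ} [Fact p.Prime] (κ : ZpExtension K p)

/-- **`#(Γ_K ⧸ Γ_n) = p^n`** for the `n`-th layer subgroup of a `ℤ_p`-extension (`ZpExtension.index_layerSubgroup`); at `p = 2`, `n = nfl w`, this is the
number `2^{nfl w}` of conjugate copies `c : C w` of the block at `w` (the primes of `ℚ_∞` above `w`). [cite: GreenbergVatsal2000, §2 Prop. (2.4)] -/
theorem natCard_quotient_layerSubgroup (n : ℕ) : Nat.card (Field.absoluteGaloisGroup K ⧸ κ.layerSubgroup n) = p ^ n := by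
  rw [← Subgroup.index_eq_card, κ.index_layerSubgroup]

end Layer

end Summit.BirchSwinnertonDyer.BirchSwinnertonDyer.Theorems.ThetaTransport.LocalBlockCount

end
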